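import Summits.QuantumFields.YangMills.Theses.LangevinControlUV
import Summits.QuantumFields.YangMills.Theorems.FemtoCurvatureSkewness.Negative.ZeroCoupling
import Summits.QuantumFields.YangMills.Theorems.FemtoCurvatureSkewness.Negative.WeakCoupling
import Summits.QuantumFields.YangMills.Theorems.FemtoCurvatureSkewness.Negative.WildPackage
import Summits.QuantumFields.YangMills.Theorems.FemtoCurvatureSkewness.Negative.FalseOfUniformZeros
import Summits.QuantumFields.YangMills.Theorems.LangevinControlUVFemtoCurvatureSkewnessTotalCumulance
import Literature.MathematicalPhysics.QuantumLattice.LatticeGaugeDLR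

/-!
# Line `dirichlet-window-skewness` — crux `LangevinControlUV.FemtoCurvatureSkewness` (item stmt-QuantumFields-9365)

Skeleton (crux-plan, planner-cruxplan-stmt-QuantumFields-9365-dirichlet-window-ske-0, 2026-08-16) of the idea card
`Cruxes/FemtoCurvatureSkewness/Ideas/dirichlet-window-skewness.md` (triage r1-1 / r1-2: pass, "a MODULE — the
lattice-artefact layer `n ≤ n₁` of the crux for ALL volumes and EVERY unit map"), written over the LANDED vocabulary
of the crux (`Theorems/FemtoCurvatureSkewness/Negative/ZeroCoupling.lean`: `plaq`, `wE`, `wCov`, `kappa3`,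
`TwoPointPackage`, `SkewnessPackage`; the crux is definitionally `∀ G simple, ∀ r a, TwoPointPackage r a →
SkewnessPackage r a`, `crux_iff`) and the tree's DLR vocabulary (`LatticeGaugeDLR.lean`: `ymSpecification`,
`plaquettesTouching`, `plaquetteObs`, `torusLift`, `box`).

THE LINE.  Condition on every link OUTSIDE the mesoscopic window `Λ = {−R..R}⁴`, `R = ⌈β^θ⌉`, around the triangle
`(0, ne₂, ne₃)` and expand `κ₃` by Brillinger's law of total cumulance (LANDED, `TotalCumulance` p91552): the torus
conditional law is Wilson's DLR kernel `γ_Λ(·|ω)` (tree `wilsonExpectation_toTorusObservable_eq` /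
`integral_torusLift_eq_integral_ymSpecification`, every torus `L ≥ 2R+3`), so
  (inner, `DirichletSkewLaplace`) the conditional skewness at the centre of a RIGID Dirichlet box (gauge-unique
  small-field minimiser, no torons, no `L`) is a finite-dimensional Laplace problem: the positive Dirichlet permanental
  triangle `A/(β³n¹²)` minus dressings that are polynomials in the three conditional excess actions `D₀, D_y, D_z`;
  (outer, `SkewBudget` + `WindowLargeFieldRarity`) the exterior enters only through `μ_L`-MOMENTS of the `D`'s (sizes,
  not signs) and the rarity of large plaquettes near the window, uniformly in the volume;
  (`WindowTransfer`) the five terms of total cumulance are then `≥ A/(β³n¹²) − O(δ)/β³`: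
  `LargeTorusBound` (every `L ≥ 2⌈β^θ⌉+3`), and with the fixed-torus corner `SmallTorusSkewness`
  (card toron-resolved-corner, `8n ≤ L < 2⌈β^θ⌉+3`) the a-free, volume-uniform ARTEFACT LAYER
  `ArtefactLayerSkewness : ∀ n ≥ 1, ∃ A' β₁, ∀ β ≥ β₁, ∀ L ≥ 8n, A' ≤ β³n¹²κ₃(L,β,n)` (glue proved below).
The layer is the part of the crux no unit map can weaken (Disproof finding 2a, now volume-uniform and SIGNED); it does
not reach the scaling range `n₀ ≤ n ≤ L/8` of femto boxes, which is an ENGINE's job: the skeleton imports it as the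
∃-bundled ratio core `FemtoRatioCore` (= line Sketch-ideator3's `RigidityBound` with the starting separation `n₀`
left free — implied by that line's chain `PermanentalCouplingFromInputs → DominanceFromCoupling → PermanentalRigidity`;
the layer pays for the freedom in `n₀`), and it isolates the typed `∀ a` shell in the SAME residual as that line,
`PackagePinsScale` (verbatim; false modulo covariance uniformities, `Negative/WildPackage.exists_incomparable_packages`;
the planners' repair R1 removes it: `skewnessForPackageMap_of` below closes the ∃-bundled form WITHOUT it).

Registered stubs (7): `stub_dirichletSkewLaplace` (XL, inner), `stub_skewBudget` (XL, outer moments k ≤ 3),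
`stub_windowLargeField` (M–L, large-field rarity near the window on ALL tori incl. odd — triage r1-1 (b)),
`stub_windowTransfer` (M, the decomposition), `stub_smallTorusSkewness` (L, fixed-torus corner),
`stub_femtoRatioCore` (ENGINE SOCKET, crux-sized, shared content with Sketch-ideator3), `stub_packagePinsScale`
(residual, shared verbatim with Sketch-ideator3).  Composition `FemtoCurvatureSkewness_of` (kernel-checked, no `sorry`
outside `stub_*`): layer (`artefactLayer_of_large_small`, `layer_uniform`) + core + comparability ⇒ `SkewnessPackage`
for the crux's arbitrary package map (`skewnessPackage_of_layer_core`: on `n < n₀` the bare bound `A'/β³` becomes a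
`Γ₃`-bound because `a' → 0` bounds `β` on each level `n·a'(β) = s`, `n < n₀`; on `n ≥ n₀` the ratio core and the
package's OWN lower clause give `ρ₀ (c'Γ')^{3/2}`; `Γ₃ := min` of the two — it tends to `0` at `0⁺`, as Disproof
finding 4b forces, and every threshold is eventual in `β`, as finding 4 forces).
-/

noncomputable section

namespace Summit.QuantumFields.YangMills.Cruxes.FemtoCurvatureSkewness.DirichletWindowSkewness

open MeasureTheory Filter Topology
open scoped BigOperators ENNReal
open Literature.MathematicalPhysics.QuantumFieldTheory
open Literature.MathematicalPhysics.QuantumLattice (ymSpecification plaquettesTouching plaquetteObs LGConfig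
  torusLift)
open Literature.Probability.LatticeModels (box)
open Summit.QuantumFields.YangMills.Theses.LangevinControlUV (FemtoCurvatureSkewness)
open Summit.QuantumFields.YangMills.Theorems.FemtoCurvatureSkewness.Negative
  (plaq wE wCov kappa3 TwoPointPackage SkewnessPackage)

/-! ## The window statements (inner / outer / large-field / transfer) -/

/-- **Stub 1 `DirichletSkewLaplace` — the INNER lemma (card C⁺ (i); the three-point analogue of route DirichletWindow's
`BoxLaplace`, stmt-QuantumFields-12316).**  With `Λ` = the edges based in `{−R..R}⁴`, `R = ⌈β^θ⌉`, `good` = every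
plaquette touching `Λ` has `P ≤ β^{-15/16}`, `ν_ω` = Wilson's DLR kernel `ymSpecification r.ρ β Λ ω` conditioned on
`good`, `D_x(ω) = ∫P_x dν_ω − ∫P_x dν_1` the conditional EXCESS ACTION at the `(0,1)`-plaquette at `x`, and the triangle
`0, y = n e₂, z = n e₃`: for every exterior datum `ω` whose kernel gives `good` probability `≥ 1/2`,
(i) `A/(β³n¹²) − C·S/(β²n⁸) − C·S²/(βn⁴) − C·S³ − C/β^{3+δ'} ≤ κ₃^{ν_ω}(P₀,P_y,P_z)`, `S = D₀⁺ + D_y⁺ + D_z⁺`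
(Dirichlet permanental triangle `8 c³ G_D(0,y)G_D(y,z)G_D(z,0) > 0` minus background dressings: one `h·h` pair per
missing propagator, `h² = 2D`), and (ii) for the three pairs the conditional covariances move from their flat-data
values by at most `C·S/(βn⁴) + C·S² + C/β^{2+δ'}` (the two-point dressing `h_a·h_b G_D(a,b)/β`).  Single-scale Laplace
about the constrained small-field minimiser in one exponential chart (`sup|a| ≤ 4Rβ^{-15/32} < 1`); closes for small
`θ` (cubic remainder `R⁶β^{-13/32}`), whence `θ` is existential; `β₁(n) ≥ (3n)^{1/θ}` is astronomically large (fine: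
existential).  [XL] -/
def DirichletSkewLaplace : Prop :=
  ∀ (G : Type) [Group G] [TopologicalSpace G] [IsTopologicalGroup G] [CompactSpace G]
    [MeasurableSpace G] [BorelSpace G], IsCompactSimpleLieGroup G → ∀ r : LatticeRep G,
    ∃ θ A C δ' : ℝ, 0 < θ ∧ θ ≤ 1 / 16 ∧ 0 < A ∧ 0 < δ' ∧ ∀ n : ℕ, 1 ≤ n →
      ∃ β₁ : ℝ, ∀ β : ℝ, β₁ ≤ β →
        let Λ : Finset (Literature.MathematicalPhysics.QuantumLattice.ZdEdge 4) := box 4 ⌈β ^ θ⌉₊ ×ˢ (Finset.univ : Finset (Fin 4))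
        let good : Set (LGConfig 4 G) :=
          {U | ∀ p ∈ plaquettesTouching Λ,
            (r.N : ℝ) - plaquetteObs r.ρ p.1 p.2.1.1 p.2.1.2 U ≤ β ^ (-(15 : ℝ) / 16)}
        let ν : LGConfig 4 G → Measure (LGConfig 4 G) :=
          fun η => ProbabilityTheory.cond (ymSpecification r.ρ β Λ η) good
        let P : Literature.Probability.LatticeModels.Site 4 → LGConfig 4 G → ℝ :=
          fun x U => (r.N : ℝ) - plaquetteObs r.ρ x 0 1 U
        let D : Literature.Probability.LatticeModels.Site 4 → LGConfig 4 G → ℝ :=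
          fun x η => (∫ U, P x U ∂(ν η)) - ∫ U, P x U ∂(ν 1)
        let y : Literature.Probability.LatticeModels.Site 4 := (n : ℤ) • Pi.single (2 : Fin 4) (1 : ℤ)
        let z : Literature.Probability.LatticeModels.Site 4 := (n : ℤ) • Pi.single (3 : Fin 4) (1 : ℤ)
        let cov : Measure (LGConfig 4 G) → Literature.Probability.LatticeModels.Site 4 →
            Literature.Probability.LatticeModels.Site 4 → ℝ :=
          fun m a b => (∫ U, P a U * P b U ∂m) - (∫ U, P a U ∂m) * ∫ U, P b U ∂m
        let cum : Measure (LGConfig 4 G) → ℝ := fun m =>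
          ∫ U, (P 0 U - ∫ V, P 0 V ∂m) * (P y U - ∫ V, P y V ∂m) * (P z U - ∫ V, P z V ∂m) ∂m
        ∀ ω : LGConfig 4 G, (2⁻¹ : ℝ≥0∞) ≤ ymSpecification r.ρ β Λ ω good →
          let S : ℝ := max (D 0 ω) 0 + max (D y ω) 0 + max (D z ω) 0
          A / (β ^ 3 * (n : ℝ) ^ 12) - C * S / (β ^ 2 * (n : ℝ) ^ 8) - C * S ^ 2 / (β * (n : ℝ) ^ 4)
              - C * S ^ 3 - C / β ^ (3 + δ') ≤ cum (ν ω) ∧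
          ∀ ab ∈ [((0 : Literature.Probability.LatticeModels.Site 4), y), (0, z), (y, z)],
            |cov (ν ω) ab.1 ab.2 - cov (ν 1) ab.1 ab.2| ≤
              C * S / (β * (n : ℝ) ^ 4) + C * S ^ 2 + C / β ^ (2 + δ')

/-- **Stub 2 `SkewBudget` — the OUTER moment budget on FINITE tori (card C⁺ (ii), `SkewBudget`; the three-site,
third-moment, finite-volume form of route DirichletWindow's `BackgroundBudget`, stmt-QuantumFields-12315).**  For every
window exponent `θ ∈ (0, 1/16]` and every `δ > 0`, eventually in `β`, on EVERY torus `L ≥ 2⌈β^θ⌉ + 3` (even or odd)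
and at every separation with `3n ≤ ⌈β^θ⌉`, the conditional excess actions at the three plaquettes `0, ne₂, ne₃`,
read on the torus through the periodic lift, have `E_{L,β} |D_x|^k ≤ δ/β^k` for `k = 1, 2, 3` — "equipartition leaves no
room for background energy": thermal Dirichlet data induce `D ≍ β^{-1-4θ}`, coherent boundary curvature is a large
deviation.  Mechanism of the card: Griffiths/subgradient squeeze on the convex torus pressure with the SHARP free energy
`f_r(β) + (3 dim G/2) log β → K` (`FreeEnergyLogCoefficient`, stmt-QuantumFields-8759, mechanised for `U(N)` only) plus
chessboard exponential moments (tree RP facts; even `L`).  Thin points: an intermittent-curvature state; the thermodynamic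
squeeze alone reaches only `L ≳ (β/δ)^{1/2}` — mid-size tori `β^{1/8} ≲ L ≲ β^{1/2}` and odd `L` need the direct
(chessboard / cluster) argument.  [XL] -/
def SkewBudget : Prop :=
  ∀ (G : Type) [Group G] [TopologicalSpace G] [IsTopologicalGroup G] [CompactSpace G]
    [MeasurableSpace G] [BorelSpace G], IsCompactSimpleLieGroup G → ∀ r : LatticeRep G,
    ∀ θ : ℝ, 0 < θ → θ ≤ 1 / 16 → ∀ δ : ℝ, 0 < δ → ∃ β₁ : ℝ, ∀ β : ℝ, β₁ ≤ β →
      let Λ : Finset (Literature.MathematicalPhysics.QuantumLattice.ZdEdge 4) := box 4 ⌈β ^ θ⌉₊ ×ˢ (Finset.univ : Finset (Fin 4))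
      let good : Set (LGConfig 4 G) :=
        {U | ∀ p ∈ plaquettesTouching Λ,
          (r.N : ℝ) - plaquetteObs r.ρ p.1 p.2.1.1 p.2.1.2 U ≤ β ^ (-(15 : ℝ) / 16)}
      let ν : LGConfig 4 G → Measure (LGConfig 4 G) :=
        fun η => ProbabilityTheory.cond (ymSpecification r.ρ β Λ η) good
      let P : Literature.Probability.LatticeModels.Site 4 → LGConfig 4 G → ℝ :=
        fun x U => (r.N : ℝ) - plaquetteObs r.ρ x 0 1 U
      let D : Literature.Probability.LatticeModels.Site 4 → LGConfig 4 G → ℝ :=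
        fun x η => (∫ U, P x U ∂(ν η)) - ∫ U, P x U ∂(ν 1)
      ∀ n : ℕ, 1 ≤ n → 3 * n ≤ ⌈β ^ θ⌉₊ →
        let y : Literature.Probability.LatticeModels.Site 4 := (n : ℤ) • Pi.single (2 : Fin 4) (1 : ℤ)
        let z : Literature.Probability.LatticeModels.Site 4 := (n : ℤ) • Pi.single (3 : Fin 4) (1 : ℤ)
        ∀ (L : ℕ) [NeZero L], 2 * ⌈β ^ θ⌉₊ + 3 ≤ L →
          ∀ x ∈ [(0 : Literature.Probability.LatticeModels.Site 4), y, z], ∀ k : ℕ, 1 ≤ k → k ≤ 3 →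
            wE r L β (fun U => |D x (torusLift L U)| ^ k) ≤ δ / β ^ k

/-- **Stub 3 `WindowLargeFieldRarity` — large plaquettes near the window are rare, on EVERY torus (the large-field
input triage r1-1 (b) asked to be named; the same gap the refuter of DirichletWindow's `WindowReduction`, 12317,
flagged).**  For `θ ∈ (0, 1/16]`, `δ > 0`, eventually in `β`, on every torus `L ≥ 2⌈β^θ⌉ + 3`:
`μ_{L,β}{some plaquette touching Λ has P > β^{-15/16}} ≤ δ/β³` (`≈ β^{4θ}` plaquettes, each a stretched-exponential
tail `e^{-cβ^{1/16}}`).  Even `L`: chessboard estimate from the tree's reflection positivity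
(`wilsonExpectation_reflectionPositive_holds`, site/odd/link RP) and a one-plaquette constrained free energy; odd `L`:
site-reflection chessboard or an independent local large-field bound — the a-priori `⟨P⟩ ≤ C log β/β` (Chatterjee, all
`L`) with Markov gives only `β^{-1/16} log β`, not enough.  It controls BOTH bad-data corrections of the transfer:
`E_μ[γ_Λ(goodᶜ|ω)] = μ(goodᶜ)` (DLR) and `μ{γ_Λ(good|ω) < 1/2} ≤ 2 μ(goodᶜ)` (Markov).  [M–L] -/
def WindowLargeFieldRarity : Prop :=
  ∀ (G : Type) [Group G] [TopologicalSpace G] [IsTopologicalGroup G] [CompactSpace G]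
    [MeasurableSpace G] [BorelSpace G], IsCompactSimpleLieGroup G → ∀ r : LatticeRep G,
    ∀ θ : ℝ, 0 < θ → θ ≤ 1 / 16 → ∀ δ : ℝ, 0 < δ → ∃ β₁ : ℝ, ∀ β : ℝ, β₁ ≤ β →
      let Λ : Finset (Literature.MathematicalPhysics.QuantumLattice.ZdEdge 4) := box 4 ⌈β ^ θ⌉₊ ×ˢ (Finset.univ : Finset (Fin 4))
      let good : Set (LGConfig 4 G) :=
        {U | ∀ p ∈ plaquettesTouching Λ,
          (r.N : ℝ) - plaquetteObs r.ρ p.1 p.2.1.1 p.2.1.2 U ≤ β ^ (-(15 : ℝ) / 16)}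
      ∀ (L : ℕ) [NeZero L], 2 * ⌈β ^ θ⌉₊ + 3 ≤ L →
        wE r L β ((torusLift L ⁻¹' goodᶜ).indicator fun _ => (1 : ℝ)) ≤ δ / β ^ 3

section Torus

variable {G : Type} [Group G] [TopologicalSpace G] [IsTopologicalGroup G] [CompactSpace G]
  [MeasurableSpace G] [BorelSpace G]

/-- **Output of the window on LARGE tori**: for each separation `n ≥ 1`, a SIGNED volume-uniform lower bound
`A' ≤ β³ n¹² κ₃(L, β, n)` on every torus that holds the window, `L ≥ 2⌈β^θ⌉ + 3`, eventually in `β`. -/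
def LargeTorusBound (r : LatticeRep G) (θ : ℝ) : Prop :=
  ∀ n : ℕ, 1 ≤ n → ∃ A' β₁ : ℝ, 0 < A' ∧ ∀ β : ℝ, β₁ ≤ β →
    ∀ (L : ℕ) [NeZero L], 2 * ⌈β ^ θ⌉₊ + 3 ≤ L → A' ≤ β ^ 3 * (n : ℝ) ^ 12 * kappa3 r L β n

/-- **The complementary SMALL-torus regime** at window exponent `θ`: the finitely many tori `8n ≤ L < 2⌈β^θ⌉ + 3`,
i.e. `β > ((L−3)/2)^{1/θ} ≥ ((L−5)/2)^{16}` — deep inside the fixed-torus Laplace regime. -/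
def SmallTorusBound (r : LatticeRep G) (θ : ℝ) : Prop :=
  ∀ n : ℕ, 1 ≤ n → ∃ A' β₁ : ℝ, 0 < A' ∧ ∀ β : ℝ, β₁ ≤ β →
    ∀ (L : ℕ) [NeZero L], 8 * n ≤ L → L < 2 * ⌈β ^ θ⌉₊ + 3 → A' ≤ β ^ 3 * (n : ℝ) ^ 12 * kappa3 r L β n

/-- **The artefact layer of the crux, for EVERY unit map** (the card's `ArtefactLayerSkewness` with `n₀ = 1`): at each
fixed separation `n ≥ 1` a SIGNED lower bound `A' ≤ β³ n¹² κ₃(L,β,n)` on ALL tori `L ≥ 8n` at weak coupling — no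
relation between `L` and `β`, no unit map. -/
def ArtefactLayerSkewness (r : LatticeRep G) : Prop :=
  ∀ n : ℕ, 1 ≤ n → ∃ A' β₁ : ℝ, 0 < A' ∧ ∀ β : ℝ, β₁ ≤ β →
    ∀ (L : ℕ) [NeZero L], 8 * n ≤ L → A' ≤ β ^ 3 * (n : ℝ) ^ 12 * kappa3 r L β n

/-- **Ratio (rigidity) bound from a starting separation `n₀`** for the unit map `a`: in `a`'s femto regime,
`ρ₀ · (n⁸Cov₀₂) · √(n⁸Cov₀₂) ≤ n¹²|κ₃|` for `n₀ ≤ n ≤ L/8` (`Cov₀₂ = Cov(P_0^{01}, P_{ne₂}^{01})`).  This is line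
Sketch-ideator3's `RigidityBound r a` with `1 ≤ n` weakened to `n₀ ≤ n` (`ratioBoundFrom_of_allSeparations`). -/
def RatioBoundFrom (r : LatticeRep G) (a : ℝ → ℝ) : Prop :=
  ∃ (n₀ : ℕ) (β₁ ℓ₁ ρ₀ : ℝ), 0 < ℓ₁ ∧ 0 < ρ₀ ∧
    ∀ (L : ℕ) [NeZero L] (β : ℝ), β₁ ≤ β → (L : ℝ) * a β ≤ ℓ₁ →
      ∀ n : ℕ, n₀ ≤ n → 8 * n ≤ L →
        ρ₀ * ((n : ℝ) ^ 8 *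
            wCov r L β (plaq r L 0 0 1) (plaq r L (Pi.single (2 : Fin 4) ((n : ℕ) : ZMod L)) 0 1)) *
          Real.sqrt ((n : ℝ) ^ 8 *
            wCov r L β (plaq r L 0 0 1) (plaq r L (Pi.single (2 : Fin 4) ((n : ℕ) : ZMod L)) 0 1)) ≤
        (n : ℝ) ^ 12 * |kappa3 r L β n|

end Torus

/-- **Stub 4 `WindowTransfer` — the window decomposition itself (card Transfer; "bookkeeping" on paper, an honest
M-sized lemma in Lean).**  Inner ∧ outer ∧ large-field ⇒ `LargeTorusBound` at the inner exponent `θ`: on a torus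
`L ≥ 2⌈β^θ⌉+3` the window and its plaquette collar inject (tree `injOn_torusProj_of_fst_mem_box`), the conditional law
of the torus Wilson state given the links outside the window is the kernel `γ_Λ(·|torusLift ω)` (tree
`wilsonExpectation_toTorusObservable_eq`, `integral_torusLift_eq_integral_ymSpecification`,
`isGibbsMeasure_wilsonMeasure`), Brillinger's identity (LANDED `TotalCumulance`, p91552) splits `κ₃` into
`E_μ κ₃(·|ω)` + three `Cov(P̂_a, Cov(P_b,P_c|ω))` + `κ₃(P̂₀,P̂_y,P̂_z)`; swapping `γ_Λ` for `ν_ω = γ_Λ(·|good)` costs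
`O(N³)·γ_Λ(goodᶜ|ω)` pointwise, whose `μ`-mean is `μ(goodᶜ) ≤ δ/β³` (stub 3, DLR), and `μ{γ_Λ(good|ω) < 1/2} ≤ 2δ/β³`
(Markov); then stub 1 (i) and Hölder with stub 2 give `E_μ κ₃(·|ω) ≥ A/(β³n¹²) − C(3δ n⁻⁸ + 9δ n⁻⁴ + 27δ + o(1))/β³`,
stub 1 (ii) + Hölder (exponents 2 and 3) give `|Cov(P̂_a, Cov(P_b,P_c|ω))| ≤ C'δ/(β³n⁴) + C'δ/β³`, and
`|κ₃(P̂)| ≤ max E|D̃|³ ≤ 8δ/β³`; choose `δ = δ(n, A, C)`.  [M] -/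
def WindowTransfer : Prop :=
  DirichletSkewLaplace → SkewBudget → WindowLargeFieldRarity →
    ∀ (G : Type) [Group G] [TopologicalSpace G] [IsTopologicalGroup G] [CompactSpace G]
      [MeasurableSpace G] [BorelSpace G], IsCompactSimpleLieGroup G → ∀ r : LatticeRep G,
      ∃ θ : ℝ, 0 < θ ∧ θ ≤ 1 / 16 ∧ LargeTorusBound r θ

/-- **Stub 5 `SmallTorusSkewness` — the fixed-torus corner (card toron-resolved-corner's `FixedTorusSkewnessLimit` in
the two-sided/uniform form triage r1-1 asked for).**  For every window exponent `θ ∈ (0, 1/16]` and separation `n ≥ 1`,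
eventually in `β`, `A' ≤ β³n¹²κ₃(L,β,n)` on all tori `8n ≤ L < 2⌈β^θ⌉ + 3`.  There `β > ((L−5)/2)^{16}`, far inside
the single-scale Laplace regime of the WHOLE torus (torons included): `β³κ₃ → K_L(n)`, the θ-mixture of twisted
zero-mode-removed Wick triangles, each within `(n/L)⁴ ≤ 2.2 %` of the untwisted one and positive (tree
`PerpPropagatorPos`, LANDED p90356, all `L`); what is needed is `inf_L n¹²K_L(n) > 0` and a polynomial onset
`β ≥ C L^p`, `p < 1/θ`.  Why it might fail: the SU(2) toron valley on symmetric `T⁴` is marginal (sector weights relax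
like `1/log β` — harmless for a LOWER bound since every sector's triangle is positive, fatal for power rates); 't
Hooft-twisted flat sectors for non-simply-connected `G`; uniformity of the onset in `L`.  [L] -/
def SmallTorusSkewness : Prop :=
  ∀ (G : Type) [Group G] [TopologicalSpace G] [IsTopologicalGroup G] [CompactSpace G]
    [MeasurableSpace G] [BorelSpace G], IsCompactSimpleLieGroup G → ∀ r : LatticeRep G,
    ∀ θ : ℝ, 0 < θ → θ ≤ 1 / 16 → SmallTorusBound r θ

/-- **Stub 6 `FemtoRatioCore` — the ENGINE SOCKET (imported content; crux-sized), conditional ∃-bundled form.**  For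
compact simple `G` and any `r`: IF some unit map carries the two-point package THEN some unit map carries the package
together with the ratio bound `ρ₀ (n⁸Cov₀₂)^{3/2} ≤ n¹²|κ₃|` from SOME separation `n₀` on, in its femto regime.  It is
implied by line Sketch-ideator3's `PermanentalCoupling` (via its LANDED `DominanceFromCoupling`, `HypercubicCovSymmetry`,
`PermanentalRigidity`: `CouplingBounds ⇒ DominanceBounds ⇒ RigidityBound ⇒ RatioBoundFrom`, `n₀ := 1`) and by card
coupling-cubic-response's `CubicResponseCore`; the freedom in `n₀` (lattice-artefact separations excluded) is what the
artefact layer of THIS line buys any engine.  It does not assert the sibling crux 9363.  [open-problem] -/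
def FemtoRatioCore : Prop :=
  ∀ (G : Type) [Group G] [TopologicalSpace G] [IsTopologicalGroup G] [CompactSpace G],
    IsCompactSimpleLieGroup G →
      letI : MeasurableSpace G := borel G
      haveI : BorelSpace G := ⟨rfl⟩
      ∀ (r : LatticeRep G), (∃ a : ℝ → ℝ, TwoPointPackage r a) →
        ∃ a : ℝ → ℝ, TwoPointPackage r a ∧ RatioBoundFrom r a

/-- **Stub 7 `PackagePinsScale` — the `∀ a` residual of the TYPED crux, engine-free; VERBATIM the residual stub of line
Sketch-ideator3 (one shared exposed stub for both lines).**  Two unit maps that both carry the two-point package (same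
`G`, `r`) are comparable: `ε·a ≤ a'` for all large `β`.  Status (lead's note `Negative-PackagePinsScale-lead.md`,
LANDED `Negative/WildPackage.lean`): FALSE modulo the covariance uniformities (POS, UNIF-L/B/B'/O) —
`exists_incomparable_packages` builds, below any package map, a choice-constructed package map with singleton level sets
decaying faster than `e^{-β}` times it; none of the uniformities is constructible today, so the stub is neither provable
nor refutable in Lean now.  Only the direction "no package map is faster than the engine map" is used below
(`skewnessPackage_of_layer_core`); the planners' repair R1 (∃-bundled crux, what `closes` consumes) deletes the stub:
`skewnessForPackageMap_of`.  [residual] -/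
def PackagePinsScale : Prop :=
  ∀ (G : Type) [Group G] [TopologicalSpace G] [IsTopologicalGroup G] [CompactSpace G],
    IsCompactSimpleLieGroup G →
      letI : MeasurableSpace G := borel G
      haveI : BorelSpace G := ⟨rfl⟩
      ∀ (r : LatticeRep G) (a a' : ℝ → ℝ), TwoPointPackage r a → TwoPointPackage r a' →
        ∃ ε β₂ : ℝ, 0 < ε ∧ ∀ β : ℝ, β₂ ≤ β → ε * a β ≤ a' β

/-! ## Registered obligations, by stub name

`Obligation.stub_<name>` is the statement the registered stub `stub_<name>` promises (a reducible alias of the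
human-named `def` above), so that the composition `FemtoCurvatureSkewness_of` takes its hypotheses BY STUB NAME
(the skeleton audit admits exactly the declared stubs). -/

namespace Obligation

/-- Obligation of `stub_dirichletSkewLaplace`. -/
abbrev stub_dirichletSkewLaplace : Prop := DirichletSkewLaplace

/-- Obligation of `stub_skewBudget`. -/
abbrev stub_skewBudget : Prop := SkewBudget

/-- Obligation of `stub_windowLargeField`. -/
abbrev stub_windowLargeField : Prop := WindowLargeFieldRarity

/-- Obligation of `stub_windowTransfer`. -/
abbrev stub_windowTransfer : Prop := WindowTransfer

/-- Obligation of `stub_smallTorusSkewness`. -/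
abbrev stub_smallTorusSkewness : Prop := SmallTorusSkewness

/-- Obligation of `stub_femtoRatioCore`. -/
abbrev stub_femtoRatioCore : Prop := FemtoRatioCore

/-- Obligation of `stub_packagePinsScale`. -/
abbrev stub_packagePinsScale : Prop := PackagePinsScale

end Obligation

/-! ## Registered stubs (`sorry` lives only here) -/

/-- Stub 1 (inner Dirichlet Laplace lemma), registered form. -/
theorem stub_dirichletSkewLaplace : DirichletSkewLaplace := by
  sorry

/-- Stub 2 (outer moment budget), registered form. -/
theorem stub_skewBudget : SkewBudget := by
  sorry

/-- Stub 3 (large-field rarity near the window, all tori), registered form. -/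
theorem stub_windowLargeField : WindowLargeFieldRarity := by
  sorry

/-- Stub 4 (the window decomposition), registered form. -/
theorem stub_windowTransfer : WindowTransfer := by
  sorry

/-- Stub 5 (fixed-torus corner), registered form. -/
theorem stub_smallTorusSkewness : SmallTorusSkewness := by
  sorry

/-- Stub 6 (ENGINE SOCKET), registered form. -/
theorem stub_femtoRatioCore : FemtoRatioCore := by
  sorry

/-- Stub 7 (shared residual), registered form. -/
theorem stub_packagePinsScale : PackagePinsScale := by
  sorry

/-! ## The composition (kernel-checked; no `sorry` below this line) -/

/-- **The crux, unbundled** (definitional). -/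
theorem crux_iff : FemtoCurvatureSkewness ↔
    ∀ (G : Type) [Group G] [TopologicalSpace G] [IsTopologicalGroup G] [CompactSpace G],
      IsCompactSimpleLieGroup G →
        letI : MeasurableSpace G := borel G
        haveI : BorelSpace G := ⟨rfl⟩
        ∀ (r : LatticeRep G) (a : ℝ → ℝ), TwoPointPackage r a → SkewnessPackage r a :=
  Iff.rfl

section Glue

variable {G : Type} [Group G] [TopologicalSpace G] [IsTopologicalGroup G] [CompactSpace G]
  [MeasurableSpace G] [BorelSpace G]

/-- The sibling line's all-separations rigidity bound is the case `n₀ = 1` of the socket's `RatioBoundFrom`. -/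
theorem ratioBoundFrom_of_allSeparations (r : LatticeRep G) (a : ℝ → ℝ)
    (h : ∃ (β₁ ℓ₁ c₃ : ℝ), 0 < ℓ₁ ∧ 0 < c₃ ∧
      ∀ (L : ℕ) [NeZero L] (β : ℝ), β₁ ≤ β → (L : ℝ) * a β ≤ ℓ₁ →
        ∀ n : ℕ, 1 ≤ n → 8 * n ≤ L →
          c₃ * ((n : ℝ) ^ 8 *
              wCov r L β (plaq r L 0 0 1) (plaq r L (Pi.single (2 : Fin 4) ((n : ℕ) : ZMod L)) 0 1)) *
            Real.sqrt ((n : ℝ) ^ 8 *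
              wCov r L β (plaq r L 0 0 1) (plaq r L (Pi.single (2 : Fin 4) ((n : ℕ) : ZMod L)) 0 1)) ≤
          (n : ℝ) ^ 12 * |kappa3 r L β n|) :
    RatioBoundFrom r a := by
  obtain ⟨β₁, ℓ₁, c₃, hℓ₁, hc₃, H⟩ := h
  exact ⟨1, β₁, ℓ₁, c₃, hℓ₁, hc₃, fun L _ β hβ hL n hn h8 => H L β hβ hL n hn h8⟩

/-- **Glue (proved): the two volume regimes with a COMMON exponent `θ` cover every torus `L ≥ 8n`.** -/
theorem artefactLayer_of_large_small (r : LatticeRep G) {θ : ℝ} (hL : LargeTorusBound r θ)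
    (hS : SmallTorusBound r θ) : ArtefactLayerSkewness r := by
  intro n hn
  obtain ⟨A₁, b₁, hA₁, h₁⟩ := hS n hn
  obtain ⟨A₂, b₂, hA₂, h₂⟩ := hL n hn
  refine ⟨min A₁ A₂, max b₁ b₂, lt_min hA₁ hA₂, fun β hβ L _ h8 => ?_⟩
  have hβ₁ : b₁ ≤ β := le_trans (le_max_left _ _) hβ
  have hβ₂ : b₂ ≤ β := le_trans (le_max_right _ _) hβ
  rcases Nat.lt_or_ge L (2 * ⌈β ^ θ⌉₊ + 3) with hlt | hge
  · exact (min_le_left _ _).trans (h₁ β hβ₁ L h8 hlt)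
  · exact (min_le_right _ _).trans (h₂ β hβ₂ L hge)

/-- **Glue (proved): uniform constants on an initial segment of separations** (finite min/max by induction). -/
theorem layer_uniform (r : LatticeRep G) (h : ArtefactLayerSkewness r) :
    ∀ n₁ : ℕ, ∃ A b : ℝ, 0 < A ∧ ∀ n : ℕ, 1 ≤ n → n ≤ n₁ → ∀ β : ℝ, b ≤ β →
      ∀ (L : ℕ) [NeZero L], 8 * n ≤ L → A ≤ β ^ 3 * (n : ℝ) ^ 12 * kappa3 r L β n := by
  intro n₁
  induction n₁ with
  | zero => exact ⟨1, 0, one_pos, fun n hn hn0 => absurd hn0 (by omega)⟩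
  | succ m ih =>
    obtain ⟨A, b, hA, hAb⟩ := ih
    obtain ⟨A', b', hA', hAb'⟩ := h (m + 1) (Nat.succ_pos m)
    refine ⟨min A A', max b b', lt_min hA hA', fun n hn hnm β hβ L _ h8 => ?_⟩
    rcases Nat.lt_or_ge n (m + 1) with hlt | hge
    · exact (min_le_left _ _).trans (hAb n hn (by omega) β ((le_max_left _ _).trans hβ) L h8)
    · have hnm' : n = m + 1 := le_antisymm hnm hge
      subst hnm'
      exact (min_le_right _ _).trans (hAb' β ((le_max_right _ _).trans hβ) L h8)

/-- **Glue (proved): layer + ratio core on the boxes of a comparable map ⇒ the skewness package.**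
For `β` large the regime `L·a' ≤ ε ℓ₁` lies inside `L·a₀ ≤ ℓ₁`; on `n ≥ n₀` the ratio core and the package of `a'`
ITSELF give `ρ₀ (c'Γ'(n a' β))^{3/2} ≤ n¹²|κ₃|`; on `1 ≤ n < n₀` the layer gives `A/β³ ≤ n¹²|κ₃|` on ALL tori, and
`a' → 0` bounds `β < T(s)` on the level `n·a'(β) = s` (because `a'(β) = s/n ≥ s/(n₀+1)` is eventually false), so
`A/T(s)³` is a legitimate value of `Γ₃` there; `Γ₃ := min` of the two. -/
theorem skewnessPackage_of_layer_core (r : LatticeRep G) {a₀ a' : ℝ → ℝ} (hLayer : ArtefactLayerSkewness r)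
    (hCore : RatioBoundFrom r a₀) {ε β₂ : ℝ} (hε : 0 < ε) (hcmp : ∀ β : ℝ, β₂ ≤ β → ε * a₀ β ≤ a' β)
    (ha' : TwoPointPackage r a') : SkewnessPackage r a' := by
  classical
  obtain ⟨n₀, β₁, ℓ₁, ρ₀, hℓ₁, hρ₀, hLB⟩ := hCore
  obtain ⟨Γ', β₀', ℓ₀', c', C', hℓ₀', hc', ha'pos, ha'0, hΓ', hpack'⟩ := ha'
  obtain ⟨A, bL, hA, hAb⟩ := layer_uniform r hLayer n₀
  -- the level bound `T s` from `a' → 0`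
  have hT : ∀ s : ℝ, ∃ T : ℝ, 1 ≤ T ∧ (0 < s → ∀ β : ℝ, T ≤ β → a' β < s / ((n₀ : ℝ) + 1)) := by
    intro s
    by_cases hs : 0 < s
    · have hq : 0 < s / ((n₀ : ℝ) + 1) := div_pos hs (by positivity)
      have hev : ∀ᶠ β in atTop, a' β ∈ Set.Iio (s / ((n₀ : ℝ) + 1)) :=
        ha'0.eventually_mem (Iio_mem_nhds hq)
      obtain ⟨T₀, hT₀⟩ := Filter.eventually_atTop.1 hev
      refine ⟨max T₀ 1, le_max_right _ _, fun _ β hβ => ?_⟩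
      exact hT₀ β (le_trans (le_max_left _ _) hβ)
    · exact ⟨1, le_rfl, fun h => absurd h hs⟩
  choose T hT1 hTlt using hT
  -- the package data
  refine ⟨fun s => min (ρ₀ * ((c' * Γ' s) * Real.sqrt (c' * Γ' s))) (A / T s ^ 3),
    max (max (max β₁ β₂) (max β₀' bL)) 1, min (ε * ℓ₁) ℓ₀', 1,
    lt_min (mul_pos hε hℓ₁) hℓ₀', one_pos, ?_, ?_⟩
  · -- positivity of `Γ₃` on `(0, ℓ₁']`
    intro s hs hsl
    have hG' := (hΓ' s hs (hsl.trans (min_le_right _ _))).1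
    have h1 : 0 < ρ₀ * ((c' * Γ' s) * Real.sqrt (c' * Γ' s)) := by
      have : 0 < c' * Γ' s := mul_pos hc' hG'
      positivity
    have h2 : 0 < A / T s ^ 3 := div_pos hA (pow_pos (lt_of_lt_of_le one_pos (hT1 s)) 3)
    exact lt_min h1 h2
  · intro L _ β hβ hL n hn h8
    have hβ₁ : β₁ ≤ β := le_trans (le_trans (le_trans (le_max_left _ _) (le_max_left _ _)) (le_max_left _ _)) hβ
    have hβ₂ : β₂ ≤ β := le_trans (le_trans (le_trans (le_max_right _ _) (le_max_left _ _)) (le_max_left _ _)) hβ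
    have hβ₀' : β₀' ≤ β := le_trans (le_trans (le_trans (le_max_left _ _) (le_max_right _ _)) (le_max_left _ _)) hβ
    have hbL : bL ≤ β := le_trans (le_trans (le_trans (le_max_right _ _) (le_max_right _ _)) (le_max_left _ _)) hβ
    have hβ1 : (1 : ℝ) ≤ β := le_trans (le_max_right _ _) hβ
    have hβpos : 0 < β := lt_of_lt_of_le one_pos hβ1
    have hnpos : (0 : ℝ) < n := by exact_mod_cast hn
    rw [one_mul]
    by_cases hcase : n₀ ≤ n
    · -- scaling range: ratio core on an `a₀`-box + the package of `a'` itself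
      have hLa' : (L : ℝ) * a' β ≤ ℓ₀' := hL.trans (min_le_right _ _)
      have hLa : (L : ℝ) * a₀ β ≤ ℓ₁ := by
        have h1 : ε * a₀ β ≤ a' β := hcmp β hβ₂
        have h2 : (L : ℝ) * a' β ≤ ε * ℓ₁ := hL.trans (min_le_left _ _)
        have hL0 : (0 : ℝ) ≤ L := Nat.cast_nonneg L
        have h3 : ε * ((L : ℝ) * a₀ β) ≤ ε * ℓ₁ := by nlinarith [mul_le_mul_of_nonneg_left h1 hL0]
        exact le_of_mul_le_mul_left h3 hε
      have hc1 := hLB L β hβ₁ hLa n hcase h8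
      have hp1 := ((hpack' L β hβ₀' hLa').1 n hn h8).1
      set X := (n : ℝ) ^ 8 *
        wCov r L β (plaq r L 0 0 1) (plaq r L (Pi.single (2 : Fin 4) ((n : ℕ) : ZMod L)) 0 1) with hXdef
      have hlow : c' * Γ' ((n : ℝ) * a' β) ≤ X := hp1
      have hpos : 0 ≤ c' * Γ' ((n : ℝ) * a' β) := by
        have hs : 0 < (n : ℝ) * a' β := mul_pos hnpos (ha'pos β)
        have hsl : (n : ℝ) * a' β ≤ ℓ₀' := by
          have : (n : ℝ) * a' β ≤ (L : ℝ) * a' β := by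
            have : (n : ℝ) ≤ (L : ℝ) := by
              exact_mod_cast (le_trans (Nat.le_mul_of_pos_left n (by norm_num)) h8)
            exact mul_le_mul_of_nonneg_right this (ha'pos β).le
          exact this.trans hLa'
        exact (mul_pos hc' (hΓ' _ hs hsl).1).le
      have hmono : c' * Γ' ((n : ℝ) * a' β) * Real.sqrt (c' * Γ' ((n : ℝ) * a' β)) ≤ X * Real.sqrt X :=
        mul_le_mul hlow (Real.sqrt_le_sqrt hlow) (Real.sqrt_nonneg _) (hpos.trans hlow)
      calc min (ρ₀ * ((c' * Γ' ((n : ℝ) * a' β)) * Real.sqrt (c' * Γ' ((n : ℝ) * a' β)))) (A / T ((n : ℝ) * a' β) ^ 3)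
          ≤ ρ₀ * ((c' * Γ' ((n : ℝ) * a' β)) * Real.sqrt (c' * Γ' ((n : ℝ) * a' β))) := min_le_left _ _
        _ ≤ ρ₀ * (X * Real.sqrt X) := mul_le_mul_of_nonneg_left hmono hρ₀.le
        _ = ρ₀ * X * Real.sqrt X := by ring
        _ ≤ (n : ℝ) ^ 12 * |kappa3 r L β n| := hc1
    · -- artefact layer: bare bound on ALL tori, converted on the level `n·a'(β) = s`
      rw [not_le] at hcase
      have key := hAb n hn hcase.le β hbL L h8
      set s : ℝ := (n : ℝ) * a' β with hsdef
      have hs : 0 < s := mul_pos hnpos (ha'pos β)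
      -- `β < T s`: otherwise `a' β < s/(n₀+1) ≤ s/n = a' β`
      have hβT : β < T s := by
        by_contra hge
        rw [not_lt] at hge
        have hlt := hTlt s hs β hge
        have hn1 : (n : ℝ) ≤ (n₀ : ℝ) + 1 := by
          have : n ≤ n₀ + 1 := by omega
          exact_mod_cast this
        have hdiv : s / ((n₀ : ℝ) + 1) ≤ s / (n : ℝ) :=
          div_le_div_of_nonneg_left hs.le hnpos hn1
        have heq : s / (n : ℝ) = a' β := by
          rw [hsdef]; field_simp
        linarith
      have hTpos : 0 < T s := lt_of_lt_of_le one_pos (hT1 s)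
      have hpow : β ^ 3 ≤ T s ^ 3 := by
        exact pow_le_pow_left₀ hβpos.le hβT.le 3
      have hβ3 : 0 < β ^ 3 := pow_pos hβpos 3
      have hn12 : (0 : ℝ) < (n : ℝ) ^ 12 := by positivity
      -- `A ≤ β³ n¹² κ₃ ≤ β³ n¹² |κ₃|`
      have key' : A ≤ β ^ 3 * ((n : ℝ) ^ 12 * |kappa3 r L β n|) := by
        calc A ≤ β ^ 3 * (n : ℝ) ^ 12 * kappa3 r L β n := key
          _ ≤ β ^ 3 * (n : ℝ) ^ 12 * |kappa3 r L β n| :=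
              mul_le_mul_of_nonneg_left (le_abs_self _) (by positivity)
          _ = β ^ 3 * ((n : ℝ) ^ 12 * |kappa3 r L β n|) := by ring
      have hdiv1 : A / T s ^ 3 ≤ A / β ^ 3 := div_le_div_of_nonneg_left hA.le hβ3 hpow
      have hdiv2 : A / β ^ 3 ≤ (n : ℝ) ^ 12 * |kappa3 r L β n| := by
        rw [div_le_iff₀ hβ3]
        linarith [key']
      calc min (ρ₀ * ((c' * Γ' s) * Real.sqrt (c' * Γ' s))) (A / T s ^ 3)
          ≤ A / T s ^ 3 := min_le_right _ _
        _ ≤ A / β ^ 3 := hdiv1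
        _ ≤ (n : ℝ) ^ 12 * |kappa3 r L β n| := hdiv2

end Glue

/-- **`FemtoCurvatureSkewness_of`** — the composition over exactly the seven registered stubs: the window
(stubs 1–4) gives `LargeTorusBound` at some exponent `θ ≤ 1/16`, the fixed-torus corner (stub 5) at the same `θ` closes
the artefact layer on ALL tori; the engine socket (stub 6) yields a package map `a₀` with the ratio core from `n₀`;
the residual (stub 7) compares the crux's arbitrary package map `a'` with `a₀`; `skewnessPackage_of_layer_core`
closes. -/
theorem FemtoCurvatureSkewness_of (h₁ : Obligation.stub_dirichletSkewLaplace) (h₂ : Obligation.stub_skewBudget)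
    (h₃ : Obligation.stub_windowLargeField) (h₄ : Obligation.stub_windowTransfer)
    (h₅ : Obligation.stub_smallTorusSkewness) (h₆ : Obligation.stub_femtoRatioCore)
    (h₇ : Obligation.stub_packagePinsScale) : FemtoCurvatureSkewness := by
  rw [crux_iff]
  intro G _ _ _ _ hG
  letI : MeasurableSpace G := borel G
  haveI : BorelSpace G := ⟨rfl⟩
  intro r a' ha'
  obtain ⟨θ, hθ, hθ', hLarge⟩ := h₄ h₁ h₂ h₃ G hG r
  have hLayer : ArtefactLayerSkewness r := artefactLayer_of_large_small r hLarge (h₅ G hG r θ hθ hθ')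
  obtain ⟨a₀, hPkg₀, hCore₀⟩ := h₆ G hG r ⟨a', ha'⟩
  obtain ⟨ε, β₂, hε, hcmp⟩ := h₇ G hG r a₀ a' hPkg₀ ha'
  exact skewnessPackage_of_layer_core r hLayer hCore₀ hε hcmp ha'

/-- **The skeleton**: the crux modulo exactly the seven registered stubs `stub_*`. -/
theorem FemtoCurvatureSkewness_proof : FemtoCurvatureSkewness :=
  FemtoCurvatureSkewness_of stub_dirichletSkewLaplace stub_skewBudget stub_windowLargeField stub_windowTransfer
    stub_smallTorusSkewness stub_femtoRatioCore stub_packagePinsScale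

/-! ## Two by-products recorded for the lead and the tenure planner -/

section ByProducts

/-- **The line's own deliverable, a-free** (what stubs 1–5 give with NO engine and NO residual): the artefact layer of
the crux for every compact simple `G` and every `r` — SIGNED, volume-uniform, at every fixed separation. -/
theorem artefactLayerSkewness_of (h₁ : DirichletSkewLaplace) (h₂ : SkewBudget) (h₃ : WindowLargeFieldRarity)
    (h₄ : WindowTransfer) (h₅ : SmallTorusSkewness) :
    ∀ (G : Type) [Group G] [TopologicalSpace G] [IsTopologicalGroup G] [CompactSpace G]
      [MeasurableSpace G] [BorelSpace G], IsCompactSimpleLieGroup G → ∀ r : LatticeRep G,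
      ArtefactLayerSkewness r := by
  intro G _ _ _ _ _ _ hG r
  obtain ⟨θ, hθ, hθ', hLarge⟩ := h₄ h₁ h₂ h₃ G hG r
  exact artefactLayer_of_large_small r hLarge (h₅ G hG r θ hθ hθ')

/-- **The ∃-bundled (assembly-sufficient) form of the crux** (Memo-forall-a-exposure, repair R1; identical to line
Sketch-ideator3's `SkewnessForPackageMap`): IF some unit map carries the two-point package THEN some unit map carries the
package together with the skewness witness — all that `closes` consumes. -/
def SkewnessForPackageMap : Prop :=
  ∀ (G : Type) [Group G] [TopologicalSpace G] [IsTopologicalGroup G] [CompactSpace G],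
    IsCompactSimpleLieGroup G →
      letI : MeasurableSpace G := borel G
      haveI : BorelSpace G := ⟨rfl⟩
      ∀ (r : LatticeRep G), (∃ a : ℝ → ℝ, TwoPointPackage r a) →
        ∃ a : ℝ → ℝ, TwoPointPackage r a ∧ SkewnessPackage r a

/-- **R1 check (kernel):** stubs 1–6 ALONE give the ∃-bundled form — the residual `PackagePinsScale` is needed only for
the typed `∀ a` shell (`ε := 1`, `a' := a₀`). -/
theorem skewnessForPackageMap_of (h₁ : DirichletSkewLaplace) (h₂ : SkewBudget) (h₃ : WindowLargeFieldRarity)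
    (h₄ : WindowTransfer) (h₅ : SmallTorusSkewness) (h₆ : FemtoRatioCore) : SkewnessForPackageMap := by
  intro G _ _ _ _ hG
  letI : MeasurableSpace G := borel G
  haveI : BorelSpace G := ⟨rfl⟩
  intro r hex
  obtain ⟨θ, hθ, hθ', hLarge⟩ := h₄ h₁ h₂ h₃ G hG r
  have hLayer : ArtefactLayerSkewness r := artefactLayer_of_large_small r hLarge (h₅ G hG r θ hθ hθ')
  obtain ⟨a₀, hPkg₀, hCore₀⟩ := h₆ G hG r hex
  exact ⟨a₀, hPkg₀, skewnessPackage_of_layer_core r hLayer hCore₀ one_pos (β₂ := 0)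
    (fun β _ => le_of_eq (one_mul _)) hPkg₀⟩

end ByProducts

end Summit.QuantumFields.YangMills.Cruxes.FemtoCurvatureSkewness.DirichletWindowSkewness

end
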